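import Summits.QuantumFields.YangMills.Theorems.BalabanLadderIRTwistedSlabSliceHessianDeterminant
import HarnessLib

/-!
# The Gaussian constant of the twisted slab is positive and the same on all `N²` critical orbits: `0 < det A_p`, `0 < det_ℝ Δ_p`, and
# `Δ_{(i,j)} = Δ_{(i',j')}` (the centre decorations act trivially in the adjoint representation)

HELPER toward stub **T1** `TwistedSlabAnchor` (LINE `twisted-slab-continuity`, crux `IRcof` stmt-QuantumFields-26930, census row 43;
LEAD prover ym-ir-line-tsc-p1 g4; `--supports` the crux, `--as helper`).  Sequel of K27 `…SliceHessianDeterminant` (`det A_p = (det_ℝ Δ_p)³`,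
`exists_isometricFrame`), K19 `…SlicePhaseData` (`sliceHessian_isSymmetric`, `sliceHessian_pos`), K26 (`suD`, `suDadj`); Mathlib's
`LinearMap.IsSymmetric.det_eq_prod_eigenvalues` BY NAME.  Proof file: theorems only.  Norm scope `Matrix.Norms.Frobenius` (K19's currency).
* §1 `det_pos_of_isSymmetric_of_inner_pos` (product of positive eigenvalues), ★ `det_sliceHessian_pos` (`0 < det A_p`), ★ `det_covLaplacian_ladder_pos`
  (`0 < det_ℝ Δ_p`, via K27 in a Frobenius-isometric frame and `Odd.pow_pos_iff`).
* §2 `covShift_ladder_pair_eq`, `covShiftAdj_ladder_pair_eq`, ★ `covLaplacian_ladder_pair_eq`: the centre decorations `ω^i·1` conjugate trivially, so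
  `Δ_{(i,j)} = Δ_{(i',j')}` on `suFields` — all `N²` critical orbits carry THE SAME Gaussian constant (THE NUMBER's factor `N²`).
NOT here (honest scope): the window constants (K28, K29) and the assembly of THE NUMBER (K30); anything uniform in `β` (M3) or `L, t` (M4); T1-box 0∕1,
T1 proper 0∕1.

HONEST FRAMING: finite-dimensional linear algebra at one box; nothing here bears on `IRcof`, `IR`, or the Yang–Mills mass gap (Clay: NOT proved); R4 =
`BalabanLadder.UV` only.  References: M. García Pérez, A. González-Arroyo, M. Okawa, JHEP 10 (2017) 150 §2.3, §2.5; K. W. Breitung (1994) Thm 41.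
-/

set_option autoImplicit false

noncomputable section

open scoped Matrix Matrix.Norms.Frobenius InnerProductSpace
open Finset Module
open Literature.MathematicalPhysics.QuantumFieldTheory Literature.MathematicalPhysics.QuantumLattice
open Literature.Analysis.OperatorTheory Literature.Analysis.InnerProduct

namespace Summit.QuantumFields.YangMills.Cruxes.IRcof.TwistedSlab

variable {N : ℕ} [NeZero N]

/-! ## §1 Positivity of the determinants: `0 < det A_p`, `0 < det_ℝ Δ_p` -/

section DetPos

variable {W : Type*} [NormedAddCommGroup W] [InnerProductSpace ℝ W] [FiniteDimensional ℝ W]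

omit [NeZero N] in
/-- A symmetric operator with `⟪T y, y⟫ > 0` for `y ≠ 0` has positive determinant (product of its positive eigenvalues). [folklore] -/
theorem det_pos_of_isSymmetric_of_inner_pos (T : W →ₗ[ℝ] W) (hT : T.IsSymmetric) (hpos : ∀ y : W, y ≠ 0 → 0 < ⟪T y, y⟫_ℝ) :
    0 < LinearMap.det T := by
  rw [hT.det_eq_prod_eigenvalues rfl]
  refine Finset.prod_pos fun i _ => ?_
  have hb1 : ‖hT.eigenvectorBasis rfl i‖ = 1 := (hT.eigenvectorBasis rfl).orthonormal.1 i
  have hb : hT.eigenvectorBasis rfl i ≠ 0 := by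
    intro h; rw [h, norm_zero] at hb1; exact zero_ne_one hb1
  have h := hpos _ hb
  rw [hT.apply_eigenvectorBasis, real_inner_smul_left, real_inner_self_eq_norm_sq, hb1, one_pow, mul_one] at h
  simpa only [RCLike.ofReal_real_eq_id, id] using h

variable {m m₂ m₃ : ℕ} {k : ZMod N} {A B : Matrix.specialUnitaryGroup (Fin N) ℂ}
variable {V : Type*} [NormedAddCommGroup V] [InnerProductSpace ℝ V] [CompleteSpace V]

/-- ★ **`0 < det A_p`**: K19's slice Hessian at a decorated twist-eating ladder (`k` a unit, `N(m+1) ≥ 2`) has positive determinant (K19 symmetric + K20 positive).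
[cite: Breitung1994, Thm 41] -/
theorem det_sliceHessian_pos (hk : IsUnit k) (hAB : B * A * B⁻¹ * A⁻¹ = (suCenter N k : Matrix.specialUnitaryGroup (Fin N) ℂ)) (hNm : 2 ≤ N * (m + 1)) (i j : ZMod N)
    [FiniteDimensional ℝ V]
    (T_V : V ≃L[ℝ] realCoulombSlice (ladderField (n₀ := m + 1) (n₁ := m + 1) (n₂ := m₂ + 1) (n₃ := m₃ + 1)
      ![(A : Matrix (Fin N) (Fin N) ℂ), (B : Matrix (Fin N) (Fin N) ℂ), centerPhase N i • (1 : Matrix (Fin N) (Fin N) ℂ), centerPhase N j • (1 : Matrix (Fin N) (Fin N) ℂ)])) :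
    0 < LinearMap.det (sliceHessian (fun e => (⟨ladderField (n₀ := m + 1) (n₁ := m + 1) (n₂ := m₂ + 1) (n₃ := m₃ + 1)
        ![(A : Matrix (Fin N) (Fin N) ℂ), (B : Matrix (Fin N) (Fin N) ℂ), centerPhase N i • (1 : Matrix (Fin N) (Fin N) ℂ), centerPhase N j • (1 : Matrix (Fin N) (Fin N) ℂ)] e,
        ladderFieldPair_mem_specialUnitaryGroup A B i j e⟩ : Matrix.specialUnitaryGroup (Fin N) ℂ)) T_V k) :=
  det_pos_of_isSymmetric_of_inner_pos _
    (sliceHessian_isSymmetric (fun e => (⟨ladderField (n₀ := m + 1) (n₁ := m + 1) (n₂ := m₂ + 1) (n₃ := m₃ + 1)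
        ![(A : Matrix (Fin N) (Fin N) ℂ), (B : Matrix (Fin N) (Fin N) ℂ), centerPhase N i • (1 : Matrix (Fin N) (Fin N) ℂ), centerPhase N j • (1 : Matrix (Fin N) (Fin N) ℂ)] e,
        ladderFieldPair_mem_specialUnitaryGroup A B i j e⟩ : Matrix.specialUnitaryGroup (Fin N) ℂ)) T_V k)
    fun _ hy => sliceHessian_pos hk hNm (fun e => (⟨ladderField (n₀ := m + 1) (n₁ := m + 1) (n₂ := m₂ + 1) (n₃ := m₃ + 1)
        ![(A : Matrix (Fin N) (Fin N) ℂ), (B : Matrix (Fin N) (Fin N) ℂ), centerPhase N i • (1 : Matrix (Fin N) (Fin N) ℂ), centerPhase N j • (1 : Matrix (Fin N) (Fin N) ℂ)] e,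
        ladderFieldPair_mem_specialUnitaryGroup A B i j e⟩ : Matrix.specialUnitaryGroup (Fin N) ℂ))
      (twistedExponent_mk_ladderFieldPair hk hAB i j (ladderFieldPair_mem_specialUnitaryGroup A B i j)) T_V hy

/-- ★ **`0 < det_ℝ Δ_p`**: the real covariant Laplacian on `suFields` at a decorated twist-eating ladder has positive determinant
(`det A_p = (det_ℝ Δ_p)³` in a Frobenius-isometric frame, K27, and `0 < det A_p`). [cite: GarciaperezGonzalezarroyoOkawa2017, §2.5] -/
theorem det_covLaplacian_ladder_pos (hk : IsUnit k) (hAB : B * A * B⁻¹ * A⁻¹ = (suCenter N k : Matrix.specialUnitaryGroup (Fin N) ℂ)) (hNm : 2 ≤ N * (m + 1))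
    (i j : ZMod N) :
    0 < LinearMap.det (DiscreteWeitzenboeck.covLaplacian
        (suD (fun e => Matrix.specialUnitaryGroup_le_unitaryGroup (ladderFieldPair_mem_specialUnitaryGroup (n₀ := m + 1) (n₁ := m + 1) (n₂ := m₂ + 1) (n₃ := m₃ + 1) A B i j e)))
        (suDadj (fun e => Matrix.specialUnitaryGroup_le_unitaryGroup (ladderFieldPair_mem_specialUnitaryGroup (n₀ := m + 1) (n₁ := m + 1) (n₂ := m₂ + 1) (n₃ := m₃ + 1) A B i j e)))) := by
  obtain ⟨T_V, hT⟩ := exists_isometricFrame (N := N) (ladderField (n₀ := m + 1) (n₁ := m + 1) (n₂ := m₂ + 1) (n₃ := m₃ + 1)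
    ![(A : Matrix (Fin N) (Fin N) ℂ), (B : Matrix (Fin N) (Fin N) ℂ), centerPhase N i • (1 : Matrix (Fin N) (Fin N) ℂ), centerPhase N j • (1 : Matrix (Fin N) (Fin N) ℂ)])
  have h := det_sliceHessian_pos (m₂ := m₂) (m₃ := m₃) hk hAB hNm i j T_V
  rw [det_sliceHessian_eq_of_isometric hk hAB hNm T_V hT] at h
  exact (Odd.pow_pos_iff (by decide : Odd 3)).1 h

end DetPos

/-! ## §2 The centre decorations do not change the Laplacian: `Δ_{(i,j)} = Δ_{(i',j')}` -/

section Decor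

variable {n₀ n₁ n₂ n₃ : ℕ}

omit [NeZero N] in
/-- `(c•1) X (c•1)ᴴ = X` for a unit-modulus scalar. [folklore] -/
private theorem smul_one_mul_mul_conjTranspose {c : ℂ} (hc : star c * c = 1) (X : Matrix (Fin N) (Fin N) ℂ) :
    c • (1 : Matrix (Fin N) (Fin N) ℂ) * X * (c • (1 : Matrix (Fin N) (Fin N) ℂ))ᴴ = X := by
  rw [Matrix.conjTranspose_smul, Matrix.conjTranspose_one, Matrix.smul_mul, Matrix.one_mul, Matrix.mul_smul, Matrix.mul_one, smul_smul, hc, one_smul]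

omit [NeZero N] in
/-- `(c•1)ᴴ X (c•1) = X` for a unit-modulus scalar. [folklore] -/
private theorem conjTranspose_smul_one_mul_mul {c : ℂ} (hc : star c * c = 1) (X : Matrix (Fin N) (Fin N) ℂ) :
    (c • (1 : Matrix (Fin N) (Fin N) ℂ))ᴴ * X * (c • (1 : Matrix (Fin N) (Fin N) ℂ)) = X := by
  rw [Matrix.conjTranspose_smul, Matrix.conjTranspose_one, Matrix.smul_mul, Matrix.one_mul, Matrix.mul_smul, Matrix.mul_one, smul_smul, mul_comm, hc, one_smul]

omit [NeZero N] in
/-- The decorated link quadruples conjugate identically: `Γ_μ X Γ_μᴴ` does not see the centre decorations. [folklore] -/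
private theorem decor_conj_eq (A B : Matrix (Fin N) (Fin N) ℂ) (i j i' j' : ZMod N) (μ : Fin 4) (X : Matrix (Fin N) (Fin N) ℂ) :
    (![A, B, centerPhase N i • (1 : Matrix (Fin N) (Fin N) ℂ), centerPhase N j • (1 : Matrix (Fin N) (Fin N) ℂ)] : Fin 4 → Matrix (Fin N) (Fin N) ℂ) μ * X *
        ((![A, B, centerPhase N i • (1 : Matrix (Fin N) (Fin N) ℂ), centerPhase N j • (1 : Matrix (Fin N) (Fin N) ℂ)] : Fin 4 → Matrix (Fin N) (Fin N) ℂ) μ)ᴴ =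
      (![A, B, centerPhase N i' • (1 : Matrix (Fin N) (Fin N) ℂ), centerPhase N j' • (1 : Matrix (Fin N) (Fin N) ℂ)] : Fin 4 → Matrix (Fin N) (Fin N) ℂ) μ * X *
        ((![A, B, centerPhase N i' • (1 : Matrix (Fin N) (Fin N) ℂ), centerPhase N j' • (1 : Matrix (Fin N) (Fin N) ℂ)] : Fin 4 → Matrix (Fin N) (Fin N) ℂ) μ)ᴴ := by
  fin_cases μ
  · simp only [Fin.zero_eta, Matrix.cons_val_zero]
  · simp only [Fin.mk_one, Matrix.cons_val_one, Matrix.cons_val_zero]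
  · simp only [Fin.reduceFinMk, Matrix.cons_val]
    rw [smul_one_mul_mul_conjTranspose (star_centerPhase_mul_self i), smul_one_mul_mul_conjTranspose (star_centerPhase_mul_self i')]
  · simp only [Fin.reduceFinMk, Matrix.cons_val]
    rw [smul_one_mul_mul_conjTranspose (star_centerPhase_mul_self j), smul_one_mul_mul_conjTranspose (star_centerPhase_mul_self j')]

omit [NeZero N] in
/-- Same for the adjoint conjugation `Γ_μᴴ X Γ_μ`. [folklore] -/
private theorem decor_conjAdj_eq (A B : Matrix (Fin N) (Fin N) ℂ) (i j i' j' : ZMod N) (μ : Fin 4) (X : Matrix (Fin N) (Fin N) ℂ) :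
    ((![A, B, centerPhase N i • (1 : Matrix (Fin N) (Fin N) ℂ), centerPhase N j • (1 : Matrix (Fin N) (Fin N) ℂ)] : Fin 4 → Matrix (Fin N) (Fin N) ℂ) μ)ᴴ * X *
        (![A, B, centerPhase N i • (1 : Matrix (Fin N) (Fin N) ℂ), centerPhase N j • (1 : Matrix (Fin N) (Fin N) ℂ)] : Fin 4 → Matrix (Fin N) (Fin N) ℂ) μ =
      ((![A, B, centerPhase N i' • (1 : Matrix (Fin N) (Fin N) ℂ), centerPhase N j' • (1 : Matrix (Fin N) (Fin N) ℂ)] : Fin 4 → Matrix (Fin N) (Fin N) ℂ) μ)ᴴ * X *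
        (![A, B, centerPhase N i' • (1 : Matrix (Fin N) (Fin N) ℂ), centerPhase N j' • (1 : Matrix (Fin N) (Fin N) ℂ)] : Fin 4 → Matrix (Fin N) (Fin N) ℂ) μ := by
  fin_cases μ
  · simp only [Fin.zero_eta, Matrix.cons_val_zero]
  · simp only [Fin.mk_one, Matrix.cons_val_one, Matrix.cons_val_zero]
  · simp only [Fin.reduceFinMk, Matrix.cons_val]
    rw [conjTranspose_smul_one_mul_mul (star_centerPhase_mul_self i), conjTranspose_smul_one_mul_mul (star_centerPhase_mul_self i')]
  · simp only [Fin.reduceFinMk, Matrix.cons_val]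
    rw [conjTranspose_smul_one_mul_mul (star_centerPhase_mul_self j), conjTranspose_smul_one_mul_mul (star_centerPhase_mul_self j')]

omit [NeZero N] in
/-- The covariant shift at a decorated ladder does not see the centre decorations. [folklore] -/
theorem covShift_ladder_pair_eq (A B : Matrix (Fin N) (Fin N) ℂ) (i j i' j' : ZMod N) (μ : Fin 4)
    (Φ : FinTorusSite n₀ n₁ n₂ n₃ → Matrix (Fin N) (Fin N) ℂ) :
    covShift (ladderField (n₀ := n₀) (n₁ := n₁) (n₂ := n₂) (n₃ := n₃) ![A, B, centerPhase N i • (1 : Matrix (Fin N) (Fin N) ℂ), centerPhase N j • (1 : Matrix (Fin N) (Fin N) ℂ)]) μ Φ =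
      covShift (ladderField (n₀ := n₀) (n₁ := n₁) (n₂ := n₂) (n₃ := n₃) ![A, B, centerPhase N i' • (1 : Matrix (Fin N) (Fin N) ℂ), centerPhase N j' • (1 : Matrix (Fin N) (Fin N) ℂ)]) μ Φ := by
  funext x
  simp only [covShift, ladderField_apply]
  split_ifs
  · exact decor_conj_eq A B i j i' j' μ _
  · rfl

omit [NeZero N] in
/-- The adjoint covariant shift at a decorated ladder does not see the centre decorations. [folklore] -/
theorem covShiftAdj_ladder_pair_eq (A B : Matrix (Fin N) (Fin N) ℂ) (i j i' j' : ZMod N) (μ : Fin 4)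
    (Ψ : FinTorusSite n₀ n₁ n₂ n₃ → Matrix (Fin N) (Fin N) ℂ) :
    covShiftAdj (ladderField (n₀ := n₀) (n₁ := n₁) (n₂ := n₂) (n₃ := n₃) ![A, B, centerPhase N i • (1 : Matrix (Fin N) (Fin N) ℂ), centerPhase N j • (1 : Matrix (Fin N) (Fin N) ℂ)]) μ Ψ =
      covShiftAdj (ladderField (n₀ := n₀) (n₁ := n₁) (n₂ := n₂) (n₃ := n₃) ![A, B, centerPhase N i' • (1 : Matrix (Fin N) (Fin N) ℂ), centerPhase N j' • (1 : Matrix (Fin N) (Fin N) ℂ)]) μ Ψ := by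
  funext x
  simp only [covShiftAdj, ladderField_apply]
  split_ifs
  · exact decor_conjAdj_eq A B i j i' j' μ _
  · rfl

omit [NeZero N] in
/-- ★ **THE CENTRE DECORATIONS DO NOT CHANGE THE REAL COVARIANT LAPLACIAN**: `Δ_{(i,j)} = Δ_{(i',j')}` on `suFields` (the links `ω^i·1` conjugate trivially in the
adjoint representation). [cite: GarciaperezGonzalezarroyoOkawa2017, §2.3] -/
theorem covLaplacian_ladder_pair_eq (A B : Matrix.specialUnitaryGroup (Fin N) ℂ) (i j i' j' : ZMod N) :
    DiscreteWeitzenboeck.covLaplacian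
        (suD (fun e => Matrix.specialUnitaryGroup_le_unitaryGroup (ladderFieldPair_mem_specialUnitaryGroup (n₀ := n₀) (n₁ := n₁) (n₂ := n₂) (n₃ := n₃) A B i j e)))
        (suDadj (fun e => Matrix.specialUnitaryGroup_le_unitaryGroup (ladderFieldPair_mem_specialUnitaryGroup (n₀ := n₀) (n₁ := n₁) (n₂ := n₂) (n₃ := n₃) A B i j e))) =
      DiscreteWeitzenboeck.covLaplacian
        (suD (fun e => Matrix.specialUnitaryGroup_le_unitaryGroup (ladderFieldPair_mem_specialUnitaryGroup (n₀ := n₀) (n₁ := n₁) (n₂ := n₂) (n₃ := n₃) A B i' j' e)))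
        (suDadj (fun e => Matrix.specialUnitaryGroup_le_unitaryGroup (ladderFieldPair_mem_specialUnitaryGroup (n₀ := n₀) (n₁ := n₁) (n₂ := n₂) (n₃ := n₃) A B i' j' e))) := by
  have hD : suD (fun e => Matrix.specialUnitaryGroup_le_unitaryGroup (ladderFieldPair_mem_specialUnitaryGroup (n₀ := n₀) (n₁ := n₁) (n₂ := n₂) (n₃ := n₃) A B i j e)) =
      suD (fun e => Matrix.specialUnitaryGroup_le_unitaryGroup (ladderFieldPair_mem_specialUnitaryGroup (n₀ := n₀) (n₁ := n₁) (n₂ := n₂) (n₃ := n₃) A B i' j' e)) := by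
    funext μ
    refine LinearMap.ext fun Φ => Subtype.ext ?_
    rw [coe_suD, coe_suD]
    funext x
    simp only [covDeriv, covShift_ladder_pair_eq (A : Matrix (Fin N) (Fin N) ℂ) B i j i' j']
  have hDadj : suDadj (fun e => Matrix.specialUnitaryGroup_le_unitaryGroup (ladderFieldPair_mem_specialUnitaryGroup (n₀ := n₀) (n₁ := n₁) (n₂ := n₂) (n₃ := n₃) A B i j e)) =
      suDadj (fun e => Matrix.specialUnitaryGroup_le_unitaryGroup (ladderFieldPair_mem_specialUnitaryGroup (n₀ := n₀) (n₁ := n₁) (n₂ := n₂) (n₃ := n₃) A B i' j' e)) := by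
    funext μ
    refine LinearMap.ext fun Ψ => Subtype.ext ?_
    rw [coe_suDadj, coe_suDadj, covShiftAdj_ladder_pair_eq (A : Matrix (Fin N) (Fin N) ℂ) B i j i' j']
  rw [hD, hDadj]

end Decor

end Summit.QuantumFields.YangMills.Cruxes.IRcof.TwistedSlab

end
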